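import Literature.MathematicalPhysics.QuantumFieldTheory.Balaban1983to89.B6Prop26MirrorAssemblyV1
import Literature.MathematicalPhysics.QuantumFieldTheory.Balaban1983to89.B6Ineq2134TransposeLeftFactorTorus

/-!
# `Balaban1983to89.B6Prop26PairMirrorAssemblyV1` — T. Bałaban, *Propagators and renormalization transformations for lattice gauge theories. II*,
# Commun. Math. Phys. **96** (1984) 223–250 [Balaban1984PropagatorsII], Prop. 2.6 (2.137) p. 247, THE TWO-SIDED ENTRIES `P·G·D′` (a LEFT factor `P`
# — the Hölder pair difference — in front of a RIGHT-factor entry `G·D′`, `D′ = ∇*`: the member `‖ζG∇*J‖_α` of (2.137)) AT k LEVELS FOR THE GENUINE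
# `G`, BY ONE STEP OF THE TRANSPOSED WALK: `P·G·D′ = P·G₀·D′ + (P·R̃)·(G·D′)` — the assembly from displayed legs

statement-level skeleton of published theorems with citation tags; proofs where landed; nothing here is a claim about the Yang–Mills mass gap

PDF held: `paper:balaban1984-cmp96-propagators-rt-ii` (journal page = PDF page + 222); p. 247 [PDF 25] ((2.133)–(2.137), (2.141)), p. 239 [PDF 17]
((2.90)–(2.94)), p. 234 [PDF 12] (Lemma 2.1; Prop. 2.2 (2.67) — the scalar precedent of the two Hölder members) re-read this generation on the ×2 renders
`b2b-balaban-ref1/pages/1984-cmp96-propagators-rt-II/…-p025-x2.png`, `…-p017-x2.png`, `…-p012-x2.png`: *"‖ζ∇GJ‖_α, ‖ζG∇*J‖_α ≤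
O(1)(Lʲη)^{1−α}(‖ζ‖^ξ_α + |ζ|)e^{−δ₃d(y,y′)}|J|, ξ = L^{−j} (2.137) … G = G₀(I − R)⁻¹ = Σ_{n=0}^∞ G₀Rⁿ = Σ_ω h_{□₀}G_{□₀}h_{□₀}K_{□₁,□₂}G_{□₂}h_{□₂}⋯
(2.141) and the series above is convergent in the norms appearing in the inequalities (2.136)–(2.140)."*

CITATION HEADER (lean-in-tree rule) — WHAT IS REPRODUCED.  Phase-2 file of the `lit-balaban` typed skeleton (HOME `run/shared/lean/pub/lit-balaban/`), seat
**p38 gen 32**, brick 3 of the programme «(2.137)₂ `‖ζG∇*J‖_α` at k levels by the transposed walk» (bricks 1–2: `…B6Ineq2134TransposeLeftFactor`,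
`…B6Ineq2134TransposeLeftFactorTorus`); SKELETON rows B6.Prop2.6 × B6.Eq2.91 × B6.Eq2.134 × B6.Eq2.141 (cells; decls of record untouched).  THE READING.
The second Hölder member of (2.137) puts a Hölder quotient (a LEFT factor `P = P_{x,x′}`, [4] (1.109)) in front of the RIGHT-factor entry `G∇*` of (2.136)₃.
Neither walk alone reaches it (the left walk's last leg `∇G_□∇*`, the right walk's first leg read in a Hölder norm of the OUTPUT of the whole product);
print's *"reasoning in the same way as in the proof of Proposition 2.2 … convergent in the norms appearing in (2.137)"* is realised here by ONE STEP of
the transposed walk of gen 31: from `G₀Δ_a = I − R̃` (`…B6Eq291Transpose.eq291T_sum`) and `Δ_aG = I`, `G = G₀ + R̃G`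
(`…B6Prop26RightChainGeneric.leftFixedPoint_of_291T`), hence for ANY left factor `P` and right factor `D′`
`P·G·D′ = P·G₀·D′ + (P·R̃)·(G·D′)` — the first term is a sum of FIRST LEGS `P·(h_□G_□h_□)·D′` (displayed), the second composes the kernels
`P·h_{□′}G_{□′}K̃_{□,□′}` (the reversed (2.134) BEHIND `P`, brick 2's `h2134L_kFamT_torus`, from displayed legs of `P·h_□G_□`, `P·h_□G_□E_e`) with the
right entry `G·D′` under its own majorant (displayed; for `D′ = ∇*` it is gen 31's (2.136)₃ `…B6Prop26DivLegKLevelV1.prop26_2136_div_kLevel`) by ONE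
Lemma-2.1 convolution (`…B6Prop26RightChainGeneric.majorant_leftIterW` at `n = 1`) — NO new fixed point, no smallness of `θ₀` needed.
* §1 (generic block geometry) **`pairEntry_of_2133T_2134T`** — the one-step gluing: overlap `N`, first legs `1_{U_□}(a)·A_F e^{−δd}P_F(b)`, reversed
  kernels behind `P` `1_{U_{□′}}(a)1_{U_□}(b)·θ₀e^{−δd}`, right entry `A·e^{−δd(a,b)}P(b)` ⟹
  `HasMajorant (P·G·D′) (N·A_F·e^{−δd}·P_F(b) + A·(N²θ₀c)·e^{−(1−α)δd}·P(b))`;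
* §2 (the genuine V1 torus family) **`prop26_pairT_kLevel_assembly_le`** — gen 31's `prop26_2136T_kLevel_assembly_le` with the left factor in front:
  `∃ σ₀ > 0, ∀ σ ∈ (0,σ₀], α, N₀, Nbig, sizes, ∃ K₁ K₂ M₁, ∀ tori above threshold …, ∀ P` with displayed GLOBAL legs `P·h_□G_□ ≤ C_L·(L^{j(y)}/c′)²e^{−2σd}`,
  `P·h_□G_□E_e ≤ C₁·(L^{j(y)}/c′)²e^{−2σd}` and `OutLoc (P·h_□G_□) □̃`, `∀ D′` with displayed first legs and right entry:
  `HasMajorant (P·G·D′) (Nbig·C_F·e^{−σd}·P_F(y′) + A_T·(Nbig²·(K₁C_L + K₂C₁)/M·c₁)·e^{−(1−α)σd}·P_T(y′))` — the `O(M⁻¹)` of (2.135) explicit and LINEAR in the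
  leg constants (so a pair weight `t^α` carried by `C_L, C₁` passes through); every other per-cube input (member legs `G_□`, `N_k`, `P_□`, `∂(1−R)∂*`,
  the transposed commutator decomposition `hdecT_cube`, `inLoc_hB_Ml`, (2.91)ᵀ by `hagreeT_cube`/`hinvT_cube`) fed BY NAME exactly as in gen 31;
* §3 **`prop26_pairT_kLevel_final_le`** — overlap (`3·9^{d+1}`, `card_filter_mem_QbigT_le`) and line-1 sizes/supports (`B6CubeCoeffSizesV1`) DISCHARGED
  (line 3ᵀ, the legs of `P`, the first legs and the right entry displayed; line 3ᵀ is discharged by p22's `line3_cube_transpose` in the next brick).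
All theorems, proved, 0 sorry, no new `def … : Prop`; standard axioms.

HONEST SCOPE / DIVERGENCES.  (1) The legs of the left factor (`P·h_□G_□`, `P·h_□G_□E_e`, their output localisation), the first legs `P·(h_□G_□h_□)·D′` and
the right entry `G·D′` are DISPLAYED hypotheses here (bricks 4–5 discharge them for `P = P_{x,x′}`, `D′ = ∇*` from the two-scale (1.110)₂/(1.111)₂ members
and gen 31's (2.136)₃).  (2) The one-step identity is OURS (print does not spell the two-sided walk out); recorded in HOME/GAPS.md.  (3) As gen 31:
`L ≥ 5`, `M_h = L^a ≥ 8`, `R ≥ 2L²`, `P′ ≥ 5`, every cube placed, global band; rate `(1−α)σ`, `σ ≤ σ₀(d, L, b₀, b₁)`; constants depend on `d, L, b₀, b₁` and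
the displayed sizes only.  Nothing on d = 4 or the continuum; NOT summit progress.  Unit `lit-balaban-p38` (gen 32), 2026-08-23.
-/

noncomputable section

open scoped BigOperators
open Finset

namespace Literature.MathematicalPhysics.QuantumFieldTheory.Balaban1983to89.B6Prop26PairMirrorAssemblyV1

open B4Reflection242 (boxDom)
open B6MultiLevelBoxOperator (N0)
open B6MultiLevelTorusOperator (TDomains)
open B6Cover236MultiLevelBlocks (cubes)
open B6Geom246MultiLevelBox (bset blkOf)
open B6Geom246MultiLevelTorus (geomT bondT lemma21_torus triangle_refl_nonneg_T)
open B8Ineq192MultiLevelTorus (geomTB geomTB_len geomTB_M geomTB_dist)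
open B6RandomWalk (HasMajorant hasMajorant_mono hasMajorant_add BlockSupp Triangle254)
open B6Prop26Gluing (mulOp mulOp_apply LocalMajorant OutLoc InLoc ind ind_nonneg)
open B6Lemma21Repaired (Ineq261With)
open B6Ineq261LevelGap (K261 K261_nonneg)
open B6Ineq2133TwoScaleV1 (onFun)
open B6GlobalChartV1 (PV toBox domT blkV1)
open B6SectAOperatorsV1 (dE dsE dcE dcsE QE aE QsE RE BondIdx)
open B6SectAVectorModelV1 (deltaAE GE)
open B6AgreeLapV1Chart (deltaAE_split)
open B6Partition118KLevelTorusCentral (QT QbigT zetaT zetaT_nonneg zetaT_le_one not_mem_QbigT_of_zetaT_ne_one one_le_of_four_le)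
open B6Partition118KLevelTorusBinders (sLipT sLipT_nonneg abs_hT_sub_le_distT gap_QT)
open B6Prop26KLevelSkeletonV1 (hB zB ST pref pref_nonneg abs_hB_le_one blkV1_mem_QT_of_hB_ne_zero sum_mulOp_hB_sq mulOp_zB_mul_hB mulOp_hB_mul_zB)
open B6Prop26KLevelSkeletonV2 (SbigT hNov_SbigT_of_QbigT ST_subset_SbigT blkV1_mem_SbigT_of_zB_ne_zero)
open B6InMajorantTransplant (InMajorant inMajorant_mono inMajorant_smul InMajorant.localMajorant)
open B6InDecayWindowV1 (OutMajorant outMajorant_mono outMajorant_smul)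
open B6CubeWindowV1 (Placed Gl Ml Pl GlobalBand band_of_global band_le one_le_of_eight_le four_le_of_five_le)
open B6CubeInDecayV1 (hGin_cube hNin_cube hNout_cube hPlin_cube hPlout_cube)
open B6Eq292MemberTorusV1 (EC cfC c0C NC zC abs_zC_le)
open B6Dg288ChartV1 (hasMajorant_Dg_V1_TB)
open B6Prop26KLevelAssemblyV1 (hasMajorant_smul mulOp_const_mul sq_mul_pref inv_sq_mul_pref_inv lenTB_pos distT_nonneg
  hasMajorant_TB hasMajorant_T_of_TB inMajorant_TB localMajorant_TB outMajorant_TB)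
open B6Eq291Transpose (kFamT kFamT_smul eq291T_sum)
open B6OpTransposeV1 (hagreeT_cube hinvT_cube hdecT_cube inLoc_hB_Ml onFun_deltaAE_mul_GE)
open B6Prop26RightChainGeneric (leftFixedPoint_of_291T majorant_leftIterW hasMajorant_sum_indOut hasMajorant_sum₂_ind)
open B6Ineq2134TKFamKLevelExportV1 (hdecT_smul inLoc_smul inLoc_TB)
open B6Ineq2134TransposeLeftFactorTorus (h2134L_kFamT_torus)
open B6CubeCoeffSizesV1 (abs_cfC_le cfC_supp abs_c0C_le c0C_supp s1C_nonneg s2C_nonneg)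
open B6Cover236QbigOverlapV1 (card_filter_mem_QbigT_le)
open B6Partition118KLevelFineSizes (C1F C1F_nonneg)
open B6Partition118KLevelFineSecond (C2F C2F_nonneg)

variable {d ℓ : ℕ} {hd : 1 ≤ d + 1} {hL : Odd (ℓ + 1) ∧ 1 < ℓ + 1} {m K : ℕ} {Mh k R : ℕ} {P' : Fin (d + 1) → ℕ}

/-! ## §1  The one-step gluing behind a left factor (generic block geometry) -/

section Generic

variable {g : B6.Geometry} {X : Type}

open Classical in
/-- **A TWO-SIDED ENTRY `P·G·D′` BY ONE STEP OF THE TRANSPOSED WALK — GENERIC GLUING.**  Boxes `𝒟` with localisation sets `U_□` of overlap `≤ N`;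
`G₀ = Σ_□ h_□G_□h_□` with `G₀Δ_a = 1 − R̃`, `R̃ = Σ_□Σ_{□′} X̃_{□,□′}` and `Δ_aG = 1` (so `G = G₀ + R̃G`); per cube the FIRST LEG behind `P`,
`P·(h_□G_□h_□)·D′`, has majorant `1_{U_□}(a)·A_F·e^{−δd(a,b)}·P_F(b)`; per pair the reversed kernel behind `P`, `P·X̃_{□,□′}`, has majorant
`1_{U_{□′}}(a)·1_{U_□}(b)·θ₀e^{−δd(a,b)}`; the right entry `G·D′` has majorant `A·e^{−δd(a,b)}·P(b)`.  Then
`HasMajorant (P·G·D′) (N·A_F·e^{−δd(a,b)}·P_F(b) + A·(N²θ₀·c)·e^{−(1−α)δd(a,b)}·P(b))` — `P·G·D′ = P·G₀·D′ + (P·R̃)·(G·D′)`, the second term by ONE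
convolution (2.61)/(2.54) (`majorant_leftIterW`, `n = 1`). [cite: Balaban1984PropagatorsII, Prop. 2.6 (2.137) p.247, (2.141) p.247, (2.133)–(2.135) p.247,
(2.91)–(2.93) p.239, Lemma 2.1 (2.61) p.234] -/
theorem pairEntry_of_2133T_2134T (blk : X → g.Site) {ι : Type} (𝒟 : Finset ι) (U : ι → Set g.Site) {N : ℕ}
    (hover : ∀ a : g.Site, (𝒟.filter fun i => a ∈ U i).card ≤ N) (c δ α θ₀ A AF : ℝ) (P PF : g.Site → ℝ) (hA : 0 ≤ A) (hP : ∀ y, 0 ≤ P y)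
    (hAF : 0 ≤ AF) (hPF : ∀ y, 0 ≤ PF y)
    (hθ₀ : 0 ≤ θ₀) (hc : 0 ≤ c) (hα0 : 0 ≤ α) (hα1 : α ≤ 1) (hδ : 0 ≤ δ) (htri : Triangle254 g) (hdnn : ∀ a b : g.Site, 0 ≤ g.dist a b)
    (h261 : Ineq261With c g δ α)
    {G Δa D' Pp : Module.End ℝ (X → ℝ)} {h : ι → X → ℝ} {Gl : ι → Module.End ℝ (X → ℝ)} {Xt : ι → ι → Module.End ℝ (X → ℝ)}
    (hinv : Δa * G = 1) (h291T : (∑ i ∈ 𝒟, mulOp (h i) * Gl i * mulOp (h i)) * Δa = 1 - ∑ i ∈ 𝒟, ∑ i' ∈ 𝒟, Xt i i')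
    (hfirst : ∀ i ∈ 𝒟, HasMajorant blk (Pp * (mulOp (h i) * Gl i * mulOp (h i)) * D')
      (fun a b => ind (U i) a * (AF * Real.exp (-(δ * g.dist a b)) * PF b)))
    (hXt : ∀ i ∈ 𝒟, ∀ i' ∈ 𝒟, HasMajorant blk (Pp * Xt i i') (fun a b => ind (U i') a * ind (U i) b * (θ₀ * Real.exp (-(δ * g.dist a b)))))
    (hT : HasMajorant blk (G * D') (fun a b => A * Real.exp (-(δ * g.dist a b)) * P b)) :
    HasMajorant blk (Pp * G * D')
      (fun a b => (N : ℝ) * AF * Real.exp (-(δ * g.dist a b)) * PF b +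
        A * ((N : ℝ) * N * θ₀ * c) * Real.exp (-((1 - α) * δ * g.dist a b)) * P b) := by
  have hfix : G = (∑ i ∈ 𝒟, mulOp (h i) * Gl i * mulOp (h i)) + (∑ i ∈ 𝒟, ∑ i' ∈ 𝒟, Xt i i') * G :=
    leftFixedPoint_of_291T hinv h291T
  -- `P·G·D′ = Σ_□ P·(h_□G_□h_□)·D′ + (Σ_□Σ_{□′} P·X̃_{□,□′})¹·(G·D′)`
  have e1 : Pp * (∑ i ∈ 𝒟, mulOp (h i) * Gl i * mulOp (h i)) * D' = ∑ i ∈ 𝒟, Pp * (mulOp (h i) * Gl i * mulOp (h i)) * D' := by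
    rw [Finset.mul_sum, Finset.sum_mul]
  have e2 : Pp * (∑ i ∈ 𝒟, ∑ i' ∈ 𝒟, Xt i i') = ∑ i ∈ 𝒟, ∑ i' ∈ 𝒟, Pp * Xt i i' := by
    simp only [Finset.mul_sum]
  have e : Pp * G * D' = (∑ i ∈ 𝒟, Pp * (mulOp (h i) * Gl i * mulOp (h i)) * D') +
      (∑ i ∈ 𝒟, ∑ i' ∈ 𝒟, Pp * Xt i i') ^ 1 * (G * D') := by
    rw [pow_one, ← e1, ← e2]
    conv_lhs => rw [hfix]
    simp only [mul_add, add_mul, mul_assoc]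
  rw [e]
  have h1 : HasMajorant blk (∑ i ∈ 𝒟, Pp * (mulOp (h i) * Gl i * mulOp (h i)) * D')
      (fun a b => (N : ℝ) * (AF * Real.exp (-(δ * g.dist a b)) * PF b)) :=
    hasMajorant_sum_indOut 𝒟 U blk hover (fun a b => by have := hPF b; positivity) hfirst
  have hR : HasMajorant blk (∑ i ∈ 𝒟, ∑ i' ∈ 𝒟, Pp * Xt i i') (fun a b => ((N : ℝ) * N * θ₀) * Real.exp (-(δ * g.dist a b))) := by
    refine hasMajorant_mono blk (hasMajorant_sum₂_ind 𝒟 U blk hover (fun a b => mul_nonneg hθ₀ (Real.exp_nonneg _)) hXt) fun a b => ?_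
    exact (by ring : (N : ℝ) * N * (θ₀ * Real.exp (-(δ * g.dist a b))) = (N : ℝ) * N * θ₀ * Real.exp (-(δ * g.dist a b))).le
  have h2 := majorant_leftIterW blk c δ α ((N : ℝ) * N * θ₀) A P hA hP (by positivity) hc hα0 hα1 hδ htri hdnn h261 hT hR 1
  refine hasMajorant_mono blk (hasMajorant_add blk h1 h2) fun a b => ?_
  rw [pow_one]
  exact le_of_eq (by ring)

end Generic

/-! ## §2  The assembly on the genuine V1 torus: the legs of the left factor, the first legs and the right entry displayed -/

section Algebra

variable {X : Type} {g : B6.Geometry}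

/-- output localisation is stable under rescaling. [cite: Balaban1984PropagatorsII, (2.94) p.239, bookkeeping] -/
theorem outLoc_smul (blk : X → g.Site) {T : Module.End ℝ (X → ℝ)} {U : Set g.Site} (h : OutLoc blk T U) (s : ℝ) :
    OutLoc blk (s • T) U := by
  intro v x hx
  rw [LinearMap.smul_apply, Pi.smul_apply, h v x hx, smul_zero]

end Algebra

section Units

variable {D : TDomains d ℓ Mh k P' R} (hN : ∀ μ, N0 ℓ Mh k P' μ = (PV d ℓ m K hd hL).sitesPerDir 0)

/-- an output localisation transfers from `geomT D` to `geomTB D` (same sites, blocks). [cite: Balaban1984PropagatorsII, (2.45)–(2.46) p.231, dictionary] -/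
theorem outLoc_TB {T : Module.End ℝ (PBond (PV d ℓ m K hd hL) 0 → ℝ)} {U : Set (geomT D).Site}
    (h : OutLoc (g := geomT D) (blkV1 hN D) T U) : OutLoc (g := geomTB D) (blkV1 hN D) T U :=
  fun v x hx => h v x hx

end Units

section Assembly

/-- rate weakening of an exponential kernel. [folklore] -/
private theorem exp_le_exp_of_rate {ρ σ t : ℝ} (h : σ ≤ ρ) (ht : 0 ≤ t) : Real.exp (-(ρ * t)) ≤ Real.exp (-(σ * t)) :=
  Real.exp_le_exp.2 (by nlinarith)

set_option maxHeartbeats 1600000 in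
open Classical in
/-- **PROPOSITION 2.6, THE TWO-SIDED ENTRIES `P·G·D′` AT k LEVELS FOR THE GENUINE G — THE ASSEMBLY BEHIND A LEFT FACTOR.**  For the genuine `(k+1)`-level
torus family (`L ≥ 5`, `M_h = L^a ≥ 8`, `R ≥ 2L²`, `P′ ≥ 5`, every cube placed, global band `b₀ ≤ w/c′² ≤ b₁`): there is `σ₀ > 0` such that for every
rate `σ ∈ (0, σ₀]`, split `α`, Lemma-2.1 budget `N₀`, overlap count `Nbig`, line-1 sizes `s₁, s₂` and line-3ᵀ data `(C_D, c_D)` there are `K₁, K₂ ≥ 0`,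
`M₁ > 0` with: on every torus above threshold (given the displayed overlap / sizes / line 3ᵀ), for every LEFT factor `P` whose legs `P·h_□G_□`,
`P·h_□G_□E_e` have the GLOBAL majorants `C_L·(L^{j(y)}/c′)²e^{−2σd}`, `C₁·(L^{j(y)}/c′)²e^{−2σd}` and which is output-localised over `□̃`, for every right
factor `D′` and input weight `P_F ≥ 0` whose FIRST LEGS `P·(h_□G_□h_□)·D′` have the majorant `1_{□̃}(y)·C_F·e^{−2σd(y,y′)}·P_F(y′)`, and for every
majorant `A_T·e^{−σd(y,y′)}·P_T(y′)` of the right entry `G·D′`: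
`HasMajorant (P·G·D′) (Nbig·C_F·e^{−σd(y,y′)}·P_F(y′) + A_T·(Nbig²·(K₁C_L + K₂C₁)/(L·M_h)·c₁)·e^{−(1−α)σd(y,y′)}·P_T(y′))`, `c₁ = K261 N₀ (d+1) L 1 (ασ)`.
[cite: Balaban1984PropagatorsII, Prop. 2.6 (2.137) p.247, (2.141) p.247, (2.133)–(2.135) p.247, (2.88)–(2.94) pp.238–239, Lemma 2.1 p.234] -/
theorem prop26_pairT_kLevel_assembly_le (d ℓ : ℕ) (hd : 1 ≤ d + 1) (hL : Odd (ℓ + 1) ∧ 1 < ℓ + 1) {b₀ b₁ : ℝ} (hb₀ : 0 < b₀) (hb₁ : b₀ ≤ b₁) :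
    ∃ σ₀ : ℝ, 0 < σ₀ ∧ ∀ (σ : ℝ), 0 < σ → σ ≤ σ₀ → ∀ (α : ℝ), 0 ≤ α → α ≤ 1 → ∀ (N₀ : ℕ), 0 < N₀ → ∀ (Nbig : ℕ) {s₁ s₂ CD cD : ℝ},
      0 ≤ s₁ → 0 ≤ s₂ → 0 ≤ CD → 0 < cD →
    ∃ K₁ K₂ M₁ : ℝ, 0 ≤ K₁ ∧ 0 ≤ K₂ ∧ 0 < M₁ ∧
    ∀ (m K : ℕ) {Mh k R : ℕ} {P' : Fin (d + 1) → ℕ}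
      (hN : ∀ μ, N0 ℓ Mh k P' μ = (PV d ℓ m K hd hL).sitesPerDir 0) (D : TDomains d ℓ Mh k P' R) (hk : k ≤ m + K) (_ : 2 ≤ k)
      {a : ℕ} (hMha : Mh = (ℓ + 1) ^ a) (hM8 : 8 ≤ Mh) (_ : 2 * (ℓ + 1) ^ 2 ≤ R) (hP5 : ∀ μ, 5 ≤ P' μ) (_ : 4 ≤ ℓ)
      (hpl : ∀ c : ↥(cubes D.toDomains), Placed ℓ k P' c.1)
      (_ : M₁ ≤ ((ℓ : ℝ) + 1) * Mh) (_ : N₀ + 1 ≤ R * ((ℓ + 1) * Mh))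
      (_ : Real.exp (-(α * σ)) * ((ℓ : ℝ) + 1) ^ ((2 * (d + 1 : ℕ) : ℝ) / N₀) < 1)
      {cf : ℝ} (hcf : cf ≠ 0) {w : BondIdx (domT hN D hk) → ℝ} (hw : ∀ i, 0 < w i) (_ : GlobalBand b₀ b₁ cf w)
      -- the overlap count of the `□̃`
      (_ : ∀ y : (geomT D).Site, (Finset.univ.filter fun c : ↥(cubes D.toDomains) =>
        y ∈ QbigT D (one_le_of_eight_le hM8) (four_le_of_five_le hP5) c).card ≤ Nbig)
      -- the line-1 coefficients: sizes and supports
      (_ : ∀ (c : ↥(cubes D.toDomains)) (e : Fin (d + 1) × Bool) (x : PBond (PV d ℓ m K hd hL) 0),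
        |cfC hN hk (one_le_of_eight_le hM8) (four_le_of_five_le hP5) hMha c (band_le (d := d) (ℓ := ℓ) hb₀ hb₁) (hpl c) w cf e x| ≤
          s₁ * cf ^ 2 / ((geomTB D).M * (geomTB D).len (blkV1 hN D x) ^ 2))
      (_ : ∀ (c : ↥(cubes D.toDomains)) (e : Fin (d + 1) × Bool) (x : PBond (PV d ℓ m K hd hL) 0),
        cfC hN hk (one_le_of_eight_le hM8) (four_le_of_five_le hP5) hMha c (band_le (d := d) (ℓ := ℓ) hb₀ hb₁) (hpl c) w cf e x ≠ 0 →
          blkV1 hN D x ∈ ST D (one_le_of_eight_le hM8) (four_le_of_five_le hP5) c)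
      (_ : ∀ (c : ↥(cubes D.toDomains)) (x : PBond (PV d ℓ m K hd hL) 0),
        |c0C hN hk (one_le_of_eight_le hM8) (four_le_of_five_le hP5) hMha c (band_le (d := d) (ℓ := ℓ) hb₀ hb₁) (hpl c) w cf x| ≤
          s₂ * cf ^ 2 / ((geomTB D).M * (geomTB D).len (blkV1 hN D x) ^ 2))
      (_ : ∀ (c : ↥(cubes D.toDomains)) (x : PBond (PV d ℓ m K hd hL) 0),
        c0C hN hk (one_le_of_eight_le hM8) (four_le_of_five_le hP5) hMha c (band_le (d := d) (ℓ := ℓ) hb₀ hb₁) (hpl c) w cf x ≠ 0 →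
          blkV1 hN D x ∈ ST D (one_le_of_eight_le hM8) (four_le_of_five_le hP5) c)
      -- line 3ᵀ (p22's `line3_cube_transpose` shape)
      (_ : ∀ c : ↥(cubes D.toDomains), HasMajorant (g := geomTB D) (blkV1 hN D)
        (mulOp (hB hN D c) *
          (onFun (dE (P := PV d ℓ m K hd hL) cf ∘ₗ (LinearMap.id - RE (domT hN D hk) cf) ∘ₗ dsE cf) -
            Pl hN hk (one_le_of_eight_le hM8) (four_le_of_five_le hP5) hMha c (band_le (d := d) (ℓ := ℓ) hb₀ hb₁) (hpl c) w cf) *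
          mulOp (zB hN D (one_le_of_eight_le hM8) (four_le_of_five_le hP5) c))
        (fun y y'' => CD * cf ^ 2 * Real.exp (-(cD * (geomTB D).M)) / (geomTB D).len y ^ 2 * Real.exp (-((2 * σ) * (geomTB D).dist y y''))))
      -- the left factor and its legs
      (Pp : Module.End ℝ (PBond (PV d ℓ m K hd hL) 0 → ℝ)) {CL C₁ : ℝ} (_ : 0 ≤ CL) (_ : 0 ≤ C₁)
      (_ : ∀ c : ↥(cubes D.toDomains), HasMajorant (g := geomT D) (blkV1 hN D)
        (Pp * mulOp (hB hN D c) * Gl hN hk (one_le_of_eight_le hM8) (four_le_of_five_le hP5) hMha c (band_le (d := d) (ℓ := ℓ) hb₀ hb₁) (hpl c) w cf)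
        (fun y y'' => CL * pref cf y * Real.exp (-((2 * σ) * (geomT D).dist y y''))))
      (_ : ∀ (c : ↥(cubes D.toDomains)) (e : Fin (d + 1) × Bool), HasMajorant (g := geomT D) (blkV1 hN D)
        (Pp * mulOp (hB hN D c) * Gl hN hk (one_le_of_eight_le hM8) (four_le_of_five_le hP5) hMha c (band_le (d := d) (ℓ := ℓ) hb₀ hb₁) (hpl c) w cf *
          EC hN hk (one_le_of_eight_le hM8) (four_le_of_five_le hP5) hMha c (band_le (d := d) (ℓ := ℓ) hb₀ hb₁) (hpl c) w cf e)
        (fun y y'' => C₁ * pref cf y * Real.exp (-((2 * σ) * (geomT D).dist y y''))))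
      (_ : ∀ c : ↥(cubes D.toDomains), OutLoc (g := geomT D) (blkV1 hN D)
        (Pp * mulOp (hB hN D c) * Gl hN hk (one_le_of_eight_le hM8) (four_le_of_five_le hP5) hMha c (band_le (d := d) (ℓ := ℓ) hb₀ hb₁) (hpl c) w cf)
        (SbigT D (one_le_of_eight_le hM8) (four_le_of_five_le hP5) c))
      -- the right factor, the first legs behind the left factor, the right entry
      (D' : Module.End ℝ (PBond (PV d ℓ m K hd hL) 0 → ℝ)) (PF : (geomT D).Site → ℝ) (_ : ∀ y, 0 ≤ PF y) {CF : ℝ} (_ : 0 ≤ CF)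
      (_ : ∀ c : ↥(cubes D.toDomains), HasMajorant (g := geomT D) (blkV1 hN D)
        (Pp * (mulOp (hB hN D c) * Gl hN hk (one_le_of_eight_le hM8) (four_le_of_five_le hP5) hMha c (band_le (d := d) (ℓ := ℓ) hb₀ hb₁) (hpl c) w cf *
          mulOp (hB hN D c)) * D')
        (fun y y' => ind (SbigT D (one_le_of_eight_le hM8) (four_le_of_five_le hP5) c) y * (CF * Real.exp (-((2 * σ) * (geomT D).dist y y')) * PF y')))
      (PT : (geomT D).Site → ℝ) (_ : ∀ y, 0 ≤ PT y) {AT : ℝ} (_ : 0 ≤ AT)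
      (_ : HasMajorant (g := geomT D) (blkV1 hN D) (onFun (GE (domT hN D hk) hcf hw) * D')
        (fun y y' => AT * Real.exp (-(σ * (geomT D).dist y y')) * PT y')),
      HasMajorant (g := geomT D) (blkV1 hN D) (Pp * onFun (GE (domT hN D hk) hcf hw) * D')
        (fun y y' => (Nbig : ℝ) * CF * Real.exp (-(σ * (geomT D).dist y y')) * PF y' +
          AT * ((Nbig : ℝ) * Nbig * ((K₁ * CL + K₂ * C₁) * (((ℓ : ℝ) + 1) * Mh)⁻¹) * K261 N₀ (d + 1) ((ℓ : ℝ) + 1) 1 (α * σ)) *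
            Real.exp (-((1 - α) * σ * (geomT D).dist y y')) * PT y') := by
  -- ### constants of the member / global inputs (all on `d, L, b₀, b₁` only)
  have ha₀ : (0 : ℝ) < b₀ / ((ℓ + 1 : ℕ) : ℝ) := by positivity
  obtain ⟨ρN, hρN, CN, hCN, hNin⟩ := hNin_cube d ℓ hd hL ha₀ (band_le (d := d) (ℓ := ℓ) hb₀ hb₁)
  obtain ⟨ρN', hρN', CN', hCN', hNout⟩ := hNout_cube d ℓ hd hL ha₀ (band_le (d := d) (ℓ := ℓ) hb₀ hb₁)
  obtain ⟨ρP, hρP, CP, hCP, hPlin⟩ := hPlin_cube d ℓ hd hL ha₀ (band_le (d := d) (ℓ := ℓ) hb₀ hb₁)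
  obtain ⟨ρP', hρP', CP', hCP', hPlout⟩ := hPlout_cube d ℓ hd hL ha₀ (band_le (d := d) (ℓ := ℓ) hb₀ hb₁)
  obtain ⟨M₃, δ₂, C₂, hM₃, hδ₂, hC₂, hDg⟩ := hasMajorant_Dg_V1_TB d ℓ hd hL
  -- the common rate `ρ = 2σ₀` of the (2.134)ᵀ member inputs
  obtain ⟨ρ, hρ, hρN1, hρN2, hρP1, hρP2, hρD⟩ :
      ∃ ρ : ℝ, 0 < ρ ∧ ρ ≤ ρN ∧ ρ ≤ ρN' ∧ ρ ≤ ρP ∧ ρ ≤ ρP' ∧ ρ ≤ δ₂ := by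
    refine ⟨min (min ρN ρN') (min (min ρP ρP') δ₂),
      lt_min (lt_min hρN hρN') (lt_min (lt_min hρP hρP') hδ₂), ?_, ?_, ?_, ?_, ?_⟩
    · exact (min_le_left _ _).trans (min_le_left _ _)
    · exact (min_le_left _ _).trans (min_le_right _ _)
    · exact (min_le_right _ _).trans ((min_le_left _ _).trans (min_le_left _ _))
    · exact (min_le_right _ _).trans ((min_le_left _ _).trans (min_le_right _ _))
    · exact (min_le_right _ _).trans (min_le_right _ _)
  refine ⟨ρ / 2, by positivity, ?_⟩
  intro σ hσ0 hσle α hα0 hα1 N₀ hN₀ Nbig s₁ s₂ CD cD hs₁ hs₂ hCD hcD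
  have h2σ : 2 * σ ≤ ρ := by linarith
  have h2σ0 : 0 < 2 * σ := by positivity
  -- one constant for the four `N`/`P` majorants
  obtain ⟨CNN, hCNN0, hCN1, hCN2, hCP1, hCP2⟩ : ∃ CNN : ℝ, 0 ≤ CNN ∧ CN ≤ CNN ∧ CN' ≤ CNN ∧ CP ≤ CNN ∧ CP' ≤ CNN :=
    ⟨max (max CN CN') (max CP CP'), le_max_of_le_left (le_max_of_le_left hCN), le_max_of_le_left (le_max_left _ _),
      le_max_of_le_left (le_max_right _ _), le_max_of_le_right (le_max_left _ _), le_max_of_le_right (le_max_right _ _)⟩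
  have hK0 : 0 ≤ K261 N₀ (d + 1) ((ℓ : ℝ) + 1) 1 (α * σ) := K261_nonneg (by positivity) zero_le_one
  -- brick 2's threshold and constant for the REVERSED kernels behind a left factor (all constants `c′`-free)
  obtain ⟨M₁, Θ, hM₁, hΘ, h38⟩ := h2134L_kFamT_torus d ℓ (δG := 2 * σ) h2σ0
  -- `V = C_P·C_L/m + U` is LINEAR in the leg constants: `V = K₁′·C_L + K₂′·C₁`
  obtain ⟨K₁', hK₁'⟩ : ∃ K₁' : ℝ, K₁' = ((d : ℝ) + 1) * C₂ / (1 / (2 * ((ℓ : ℝ) + 1) ^ 2)) +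
      (s₂ + ((1 : ℕ) + 1) * sLipT d ℓ * ((CNN + 1) * (1 + 1)) + CD / cD) := ⟨_, rfl⟩
  obtain ⟨K₂', hK₂'⟩ : ∃ K₂' : ℝ, K₂' = (Fintype.card (Fin (d + 1) × Bool) : ℕ) * s₁ := ⟨_, rfl⟩
  have hs := sLipT_nonneg d ℓ
  have hK₁'nn : 0 ≤ K₁' := by rw [hK₁']; positivity
  have hK₂'nn : 0 ≤ K₂' := by rw [hK₂']; positivity
  refine ⟨Θ * K₁', Θ * K₂', max M₁ M₃, mul_nonneg hΘ hK₁'nn, mul_nonneg hΘ hK₂'nn, lt_max_of_lt_left hM₁, ?_⟩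
  intro m K Mh k R P' hN D hk hk2 a hMha hM8 hR2 hP5 hℓ hpl hM₁' hRM hθ cf hcf w hw hwb hNbig hcfA hcfT hc0A hc0T hD3 Pp CL C₁ hCL hC₁ hLft hLftE hLout
    D' PF hPF CF hCF hleg PT hPT AT hAT hT
  -- ### the torus
  have hMh1 : 1 ≤ Mh := one_le_of_eight_le hM8
  have hP4 : ∀ μ, 4 ≤ P' μ := four_le_of_five_le hP5
  have hP : ∀ μ, 1 ≤ P' μ := one_le_of_four_le hP4
  have hMh : 2 ≤ Mh := le_trans (by norm_num) hM8
  have hR : 2 * (ℓ + 1) ≤ R := le_trans (by nlinarith : 2 * (ℓ + 1) ≤ 2 * (ℓ + 1) ^ 2) hR2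
  have hℓ1 : 1 ≤ ℓ := le_trans (by norm_num) hℓ
  have hLM : M₁ ≤ ((ℓ : ℝ) + 1) * Mh := le_trans (le_max_left _ _) hM₁'
  have hLM₃ : M₃ ≤ ((ℓ : ℝ) + 1) * Mh := le_trans (le_max_right _ _) hM₁'
  have hcf2 : cf ^ 2 ≠ 0 := pow_ne_zero 2 hcf
  have hcf2pos : 0 < cf ^ 2 := by positivity
  have habs2 : |cf ^ 2| = cf ^ 2 := abs_of_pos hcf2pos
  have habs2i : |(cf ^ 2)⁻¹| = (cf ^ 2)⁻¹ := abs_of_pos (inv_pos.2 hcf2pos)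
  have hMpos : 0 < (geomTB D).M := by rw [geomTB_M]; positivity
  have hMeq : (geomTB D).M = ((ℓ : ℝ) + 1) * Mh := by rw [geomTB_M]
  have hdnn : ∀ y y' : (geomT D).Site, 0 ≤ (geomT D).dist y y' := distT_nonneg
  obtain ⟨htri, _, _⟩ := triangle_refl_nonneg_T D hMh1 hP
  obtain ⟨_, h261, _, _⟩ := lemma21_torus D hMh1 hP hN₀ hRM hσ0.le hα0 hα1 hθ
  -- the global `∂(1 − R)∂*` (p22), rescaled by `c′⁻²`
  have hDg' : HasMajorant (g := geomTB D) (blkV1 hN D)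
      ((cf ^ 2)⁻¹ • onFun (dE (P := PV d ℓ m K hd hL) cf ∘ₗ (LinearMap.id - RE (domT hN D hk) cf) ∘ₗ dsE cf))
      (fun y y'' => ((d : ℝ) + 1) * C₂ / (geomTB D).len y ^ 2 * Real.exp (-((2 * σ) * (geomTB D).dist y y''))) := by
    refine hasMajorant_mono _ (hasMajorant_smul _ (hDg m K hN D hk hMh1 hP4 hR hLM₃ hcf) _) fun y y'' => ?_
    rw [habs2i]
    have hl := lenTB_pos (D := D) y
    calc (cf ^ 2)⁻¹ * (cf ^ 2 * ((d : ℝ) + 1) * C₂ / (geomTB D).len y ^ 2 * Real.exp (-(δ₂ * (geomTB D).dist y y'')))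
        = ((d : ℝ) + 1) * C₂ / (geomTB D).len y ^ 2 * Real.exp (-(δ₂ * (geomTB D).dist y y'')) := by field_simp
      _ ≤ ((d : ℝ) + 1) * C₂ / (geomTB D).len y ^ 2 * Real.exp (-((2 * σ) * (geomTB D).dist y y'')) :=
          mul_le_mul_of_nonneg_left (exp_le_exp_of_rate (h2σ.trans hρD) (hdnn y y'')) (by positivity)
  -- ### brick 2's mirrored (2.134) behind the rescaled left factors `c′²•(P·h_□G_□)`
  have H := h38 D hMh1 hP hR hLM (blkV1 hN D) (CP := ((d : ℝ) + 1) * C₂) (by positivity) hDg'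
    (CL := CL) (C₁ := C₁) (CN := CNN) (CD := CD) (cD := cD) (s := sLipT d ℓ) (s₁ := s₁) (s₂ := s₂) (r₀ := 1)
    (m := 1 / (2 * ((ℓ : ℝ) + 1) ^ 2)) hCL hC₁ hCNN0 hCD hcD hs hs₁ hs₂ zero_le_one (by positivity)
    (Fintype.card (Fin (d + 1) × Bool)) 1 (Finset.univ : Finset ↥(cubes D.toDomains))
    (Lft := fun c => cf ^ 2 • (Pp * mulOp (hB hN D c) * Gl hN hk hMh1 hP4 hMha c (band_le (d := d) (ℓ := ℓ) hb₀ hb₁) (hpl c) w cf))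
    (Ml := fun c => (cf ^ 2)⁻¹ • Ml hN hk hMh1 hP4 hMha c (band_le (d := d) (ℓ := ℓ) hb₀ hb₁) (hpl c) w cf)
    (Pl := fun c => (cf ^ 2)⁻¹ • Pl hN hk hMh1 hP4 hMha c (band_le (d := d) (ℓ := ℓ) hb₀ hb₁) (hpl c) w cf)
    (h := fun c => hB hN D c) (ζ := fun c => zB hN D hMh1 hP4 c)
    (c₀ := fun c x => (cf ^ 2)⁻¹ * c0C hN hk hMh1 hP4 hMha c (band_le (d := d) (ℓ := ℓ) hb₀ hb₁) (hpl c) w cf x)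
    (T := fun c => ST D hMh1 hP4 c) (S := fun c => ST D hMh1 hP4 c) (U := fun c => SbigT D hMh1 hP4 c) (Score := fun c => SbigT D hMh1 hP4 c)
    (DE := fun _ => (Finset.univ : Finset (Fin (d + 1) × Bool)))
    (E := fun c e => EC hN hk hMh1 hP4 hMha c (band_le (d := d) (ℓ := ℓ) hb₀ hb₁) (hpl c) w cf (e.1, !e.2))
    (cf := fun c e x => (cf ^ 2)⁻¹ * cfC hN hk hMh1 hP4 hMha c (band_le (d := d) (ℓ := ℓ) hb₀ hb₁) (hpl c) w cf e x)
    (DK := fun _ => ({()} : Finset Unit))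
    (N := fun c _ => (cf ^ 2)⁻¹ • NC hN hk hMh1 hP4 hMha c (band_le (d := d) (ℓ := ℓ) hb₀ hb₁) (hpl c) w cf)
    (z := fun c _ => zC hN hk hMh1 hP4 hMha c (band_le (d := d) (ℓ := ℓ) hb₀ hb₁) (hpl c) w cf)
    -- hnE, hnK
    (fun c _ => le_of_eq Finset.card_univ) (fun c _ => by simp)
    -- hdecT (p38's `hdecT_cube`, rescaled)
    (fun c _ => hdecT_smul Finset.univ ({()} : Finset Unit)
      (N := fun _ => NC hN hk hMh1 hP4 hMha c (band_le (d := d) (ℓ := ℓ) hb₀ hb₁) (hpl c) w cf)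
      (z := fun _ => zC hN hk hMh1 hP4 hMha c (band_le (d := d) (ℓ := ℓ) hb₀ hb₁) (hpl c) w cf)
      (hdecT_cube hN hk hMh1 hP4 hMha c (band_le (d := d) (ℓ := ℓ) hb₀ hb₁) ha₀ hM8 hR2 (hpl c) w cf) _)
    -- hL (the displayed leg `P·h_□G_□`, rescaled: `c′²·(L^j/c′)² = (L^j)²`)
    (fun c _ => by
      have hx2 := hasMajorant_smul _ (hLft c) (cf ^ 2)
      refine hasMajorant_TB hN (hasMajorant_mono (g := geomT D) _ hx2 fun y y' => ?_)
      rw [habs2, ← sq_mul_pref cf hcf y, geomTB_dist]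
      exact le_of_eq (by ring))
    -- hLE (the displayed legs `P·h_□G_□E_e`, rescaled)
    (fun c _ e _ => by
      have hx2 := hasMajorant_smul _ (hLftE c (e.1, !e.2)) (cf ^ 2)
      rw [← smul_mul_assoc] at hx2
      refine hasMajorant_TB hN (hasMajorant_mono (g := geomT D) _ hx2 fun y y' => ?_)
      rw [habs2, ← sq_mul_pref cf hcf y, geomTB_dist]
      exact le_of_eq (by ring))
    -- hLout
    (fun c _ => outLoc_TB hN (outLoc_smul _ (hLout c) _))
    -- hcf, hcfS
    (fun c _ e _ x => by
      have hl := lenTB_pos (D := D) (blkV1 hN D x)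
      rw [abs_mul, habs2i]
      calc (cf ^ 2)⁻¹ * |cfC hN hk hMh1 hP4 hMha c (band_le (d := d) (ℓ := ℓ) hb₀ hb₁) (hpl c) w cf e x|
          ≤ (cf ^ 2)⁻¹ * (s₁ * cf ^ 2 / ((geomTB D).M * (geomTB D).len (blkV1 hN D x) ^ 2)) :=
            mul_le_mul_of_nonneg_left (hcfA c e x) (by positivity)
        _ = s₁ / ((geomTB D).M * (geomTB D).len (blkV1 hN D x) ^ 2) := by field_simp)
    (fun c _ e _ x hx => hcfT c e x (right_ne_zero_of_mul hx))
    -- hc₀, hc₀S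
    (fun c _ x => by
      have hl := lenTB_pos (D := D) (blkV1 hN D x)
      rw [abs_mul, habs2i]
      calc (cf ^ 2)⁻¹ * |c0C hN hk hMh1 hP4 hMha c (band_le (d := d) (ℓ := ℓ) hb₀ hb₁) (hpl c) w cf x|
          ≤ (cf ^ 2)⁻¹ * (s₂ * cf ^ 2 / ((geomTB D).M * (geomTB D).len (blkV1 hN D x) ^ 2)) :=
            mul_le_mul_of_nonneg_left (hc0A c x) (by positivity)
        _ = s₂ / ((geomTB D).M * (geomTB D).len (blkV1 hN D x) ^ 2) := by field_simp)
    (fun c _ x hx => hc0T c x (right_ne_zero_of_mul hx))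
    -- hh1, hhS, hST, hSU, hLip
    (fun c _ x => abs_hB_le_one hN D hMh1 hP c x)
    (fun c _ x hx => blkV1_mem_QT_of_hB_ne_zero hN D hMh hR hP4 c hx)
    (fun c _ => fun _ hy => hy)
    (fun c _ => ST_subset_SbigT D hMh1 hP4 c)
    (fun c _ x x' => abs_hT_sub_le_distT hℓ1 hMh hR hP5 c (toBox hN x.src) (toBox hN x'.src))
    -- hNin, hNout
    (fun c _ k _ => by
      refine inMajorant_TB hN (inMajorant_mono (g := geomT D) _ (inMajorant_smul _ (hNin m K hN D hk hMh1 hP4 hMha hMh hR2 hℓ c (hpl c) w cf) ((cf ^ 2)⁻¹))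
        (K' := fun (y y'' : (geomT D).Site) => CNN / (geomTB D).len y ^ 2 * Real.exp (-((2 * σ) * (geomT D).dist y y''))) fun y y'' _ => ?_)
      rw [habs2i]
      have hl := lenTB_pos (D := D) y
      calc (cf ^ 2)⁻¹ * (CN * (pref cf y)⁻¹ * Real.exp (-(ρN * (geomT D).dist y y'')))
          = CN * ((cf ^ 2)⁻¹ * (pref cf y)⁻¹) * Real.exp (-(ρN * (geomT D).dist y y'')) := by ring
        _ = CN / (geomTB D).len y ^ 2 * Real.exp (-(ρN * (geomT D).dist y y'')) := by rw [inv_sq_mul_pref_inv cf hcf y]; ring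
        _ ≤ CNN / (geomTB D).len y ^ 2 * Real.exp (-((2 * σ) * (geomT D).dist y y'')) :=
            mul_le_mul (div_le_div_of_nonneg_right hCN1 (by positivity)) (exp_le_exp_of_rate (h2σ.trans hρN1) (hdnn y y''))
              (Real.exp_nonneg _) (by positivity))
    (fun c _ k _ => by
      have hx := outMajorant_mono (g := geomT D) _ (outMajorant_smul _ (hNout m K hN D hk hMh1 hP4 hMha hMh hR2 hℓ c (hpl c) w cf) ((cf ^ 2)⁻¹))
        (K' := fun (y y'' : (geomT D).Site) => CNN / (geomTB D).len y ^ 2 * Real.exp (-((2 * σ) * (geomT D).dist y y''))) fun y _ y'' => by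
          rw [habs2i]
          have hl := lenTB_pos (D := D) y
          calc (cf ^ 2)⁻¹ * (CN' * (pref cf y)⁻¹ * Real.exp (-(ρN' * (geomT D).dist y y'')))
              = CN' * ((cf ^ 2)⁻¹ * (pref cf y)⁻¹) * Real.exp (-(ρN' * (geomT D).dist y y'')) := by ring
            _ = CN' / (geomTB D).len y ^ 2 * Real.exp (-(ρN' * (geomT D).dist y y'')) := by rw [inv_sq_mul_pref_inv cf hcf y]; ring
            _ ≤ CNN / (geomTB D).len y ^ 2 * Real.exp (-((2 * σ) * (geomT D).dist y y'')) :=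
                mul_le_mul (div_le_div_of_nonneg_right hCN2 (by positivity)) (exp_le_exp_of_rate (h2σ.trans hρN2) (hdnn y y''))
                  (Real.exp_nonneg _) (by positivity)
      exact outMajorant_TB hN hx)
    -- hz
    (fun c _ k _ x => abs_zC_le hN hk hMh1 hP4 hMha c (band_le (d := d) (ℓ := ℓ) hb₀ hb₁) (hpl c) w cf x)
    -- hMin (p38's `inLoc_hB_Ml`, rescaled)
    (fun c _ => by
      have hx := inLoc_smul (g := geomT D) (blkV1 hN D)
        (inLoc_hB_Ml hN hk hMh1 hP4 hMha c (band_le (d := d) (ℓ := ℓ) hb₀ hb₁) ha₀ hM8 hR2 hP5 (hpl c) w cf (hcfT c) (hc0T c)) ((cf ^ 2)⁻¹)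
      rw [← mul_smul_comm] at hx
      exact inLoc_TB hN hx)
    -- hPlin, hPlout
    (fun c _ => by
      refine inMajorant_TB hN (inMajorant_mono (g := geomT D) _ (inMajorant_smul _ (hPlin m K hN D hk hMh1 hP4 hMha hMh hR2 hℓ c (hpl c) w cf) ((cf ^ 2)⁻¹))
        (K' := fun (y y'' : (geomT D).Site) => CNN / (geomTB D).len y ^ 2 * Real.exp (-((2 * σ) * (geomT D).dist y y''))) fun y y'' _ => ?_)
      rw [habs2i]
      have hl := lenTB_pos (D := D) y
      calc (cf ^ 2)⁻¹ * (CP * (pref cf y)⁻¹ * Real.exp (-(ρP * (geomT D).dist y y'')))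
          = CP * ((cf ^ 2)⁻¹ * (pref cf y)⁻¹) * Real.exp (-(ρP * (geomT D).dist y y'')) := by ring
        _ = CP / (geomTB D).len y ^ 2 * Real.exp (-(ρP * (geomT D).dist y y'')) := by rw [inv_sq_mul_pref_inv cf hcf y]; ring
        _ ≤ CNN / (geomTB D).len y ^ 2 * Real.exp (-((2 * σ) * (geomT D).dist y y'')) :=
            mul_le_mul (div_le_div_of_nonneg_right hCP1 (by positivity)) (exp_le_exp_of_rate (h2σ.trans hρP1) (hdnn y y''))
              (Real.exp_nonneg _) (by positivity))
    (fun c _ => by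
      have hx := outMajorant_mono (g := geomT D) _ (outMajorant_smul _ (hPlout m K hN D hk hMh1 hP4 hMha hMh hR2 hℓ c (hpl c) w cf) ((cf ^ 2)⁻¹))
        (K' := fun (y y'' : (geomT D).Site) => CNN / (geomTB D).len y ^ 2 * Real.exp (-((2 * σ) * (geomT D).dist y y''))) fun y _ y'' => by
          rw [habs2i]
          have hl := lenTB_pos (D := D) y
          calc (cf ^ 2)⁻¹ * (CP' * (pref cf y)⁻¹ * Real.exp (-(ρP' * (geomT D).dist y y'')))
              = CP' * ((cf ^ 2)⁻¹ * (pref cf y)⁻¹) * Real.exp (-(ρP' * (geomT D).dist y y'')) := by ring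
            _ = CP' / (geomTB D).len y ^ 2 * Real.exp (-(ρP' * (geomT D).dist y y'')) := by rw [inv_sq_mul_pref_inv cf hcf y]; ring
            _ ≤ CNN / (geomTB D).len y ^ 2 * Real.exp (-((2 * σ) * (geomT D).dist y y'')) :=
                mul_le_mul (div_le_div_of_nonneg_right hCP2 (by positivity)) (exp_le_exp_of_rate (h2σ.trans hρP2) (hdnn y y''))
                  (Real.exp_nonneg _) (by positivity)
      exact outMajorant_TB hN hx)
    -- hζ0, hζ1, hζU, hζS
    (fun c _ x => zetaT_nonneg hMh1 hP4 c (toBox hN x.src)) (fun c _ x => zetaT_le_one hMh1 hP4 c (toBox hN x.src))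
    (fun c _ x hx => blkV1_mem_SbigT_of_zB_ne_zero hN D hMh1 hP4 c hx)
    (fun c _ x hx => not_mem_QbigT_of_zetaT_ne_one hMh1 hP4 c hx)
    -- hD3ᵀ (rescaled)
    (fun c _ => by
      have hx := hasMajorant_smul _ (hD3 c) ((cf ^ 2)⁻¹)
      have eop : (cf ^ 2)⁻¹ • (mulOp (hB hN D c) *
            (onFun (dE (P := PV d ℓ m K hd hL) cf ∘ₗ (LinearMap.id - RE (domT hN D hk) cf) ∘ₗ dsE cf) -
              Pl hN hk hMh1 hP4 hMha c (band_le (d := d) (ℓ := ℓ) hb₀ hb₁) (hpl c) w cf) * mulOp (zB hN D hMh1 hP4 c)) =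
          mulOp (hB hN D c) *
            ((cf ^ 2)⁻¹ • onFun (dE (P := PV d ℓ m K hd hL) cf ∘ₗ (LinearMap.id - RE (domT hN D hk) cf) ∘ₗ dsE cf) -
              (cf ^ 2)⁻¹ • Pl hN hk hMh1 hP4 hMha c (band_le (d := d) (ℓ := ℓ) hb₀ hb₁) (hpl c) w cf) * mulOp (zB hN D hMh1 hP4 c) := by
        simp only [smul_sub, mul_sub, sub_mul, mul_smul_comm, smul_mul_assoc]
      rw [eop] at hx
      refine hasMajorant_mono _ hx fun y y'' => le_of_eq ?_
      rw [habs2i]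
      have hl := lenTB_pos (D := D) y
      field_simp)
    -- hgap (read from the input side: the torus distance is symmetric)
    (fun c _ y'' b hy'' hb => by
      have hg := gap_QT hℓ1 hMh hR hP5 c hb hy''
      rw [SimpleGraph.dist_comm] at hg
      exact hg)
  -- ### back to the TRUE family: `(c′²•(P·h·G_□))·(c′⁻²K̃) = (P·h·G_□)·K̃`, and `V = K₁′C_L + K₂′C₁`
  have hVeq : ((d : ℝ) + 1) * C₂ * CL / (1 / (2 * ((ℓ : ℝ) + 1) ^ 2)) +
      ((Fintype.card (Fin (d + 1) × Bool) : ℕ) * (s₁ * C₁) + s₂ * CL + ((1 : ℕ) + 1) * sLipT d ℓ * ((CNN + 1) * CL * (1 + 1)) + CD * CL / cD) =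
      K₁' * CL + K₂' * C₁ := by
    rw [hK₁', hK₂']; ring
  have hXt : ∀ c c' : ↥(cubes D.toDomains), HasMajorant (g := geomT D) (blkV1 hN D)
      (Pp * mulOp (hB hN D c') * Gl hN hk hMh1 hP4 hMha c' (band_le (d := d) (ℓ := ℓ) hb₀ hb₁) (hpl c') w cf *
        kFamT (onFun (dE (P := PV d ℓ m K hd hL) cf ∘ₗ (LinearMap.id - RE (domT hN D hk) cf) ∘ₗ dsE cf))
          (fun c => mulOp (hB hN D c)) (fun c => mulOp (zB hN D hMh1 hP4 c))
          (fun c => Ml hN hk hMh1 hP4 hMha c (band_le (d := d) (ℓ := ℓ) hb₀ hb₁) (hpl c) w cf)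
          (fun c => Pl hN hk hMh1 hP4 hMha c (band_le (d := d) (ℓ := ℓ) hb₀ hb₁) (hpl c) w cf) c c')
      (fun y y' => ind (SbigT D hMh1 hP4 c') y * ind (SbigT D hMh1 hP4 c) y' *
        (Θ * (K₁' * CL + K₂' * C₁) * ((geomTB D).M)⁻¹ * Real.exp (-(σ * (geomT D).dist y y')))) := by
    intro c c'
    have h := H c (Finset.mem_univ _) c' (Finset.mem_univ _)
    have eK : (cf ^ 2 • (Pp * mulOp (hB hN D c') * Gl hN hk hMh1 hP4 hMha c' (band_le (d := d) (ℓ := ℓ) hb₀ hb₁) (hpl c') w cf)) *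
        kFamT ((cf ^ 2)⁻¹ • onFun (dE (P := PV d ℓ m K hd hL) cf ∘ₗ (LinearMap.id - RE (domT hN D hk) cf) ∘ₗ dsE cf))
          (fun c => mulOp (hB hN D c)) (fun c => mulOp (zB hN D hMh1 hP4 c))
          (fun c => (cf ^ 2)⁻¹ • Ml hN hk hMh1 hP4 hMha c (band_le (d := d) (ℓ := ℓ) hb₀ hb₁) (hpl c) w cf)
          (fun c => (cf ^ 2)⁻¹ • Pl hN hk hMh1 hP4 hMha c (band_le (d := d) (ℓ := ℓ) hb₀ hb₁) (hpl c) w cf) c c' =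
        Pp * mulOp (hB hN D c') * Gl hN hk hMh1 hP4 hMha c' (band_le (d := d) (ℓ := ℓ) hb₀ hb₁) (hpl c') w cf *
        kFamT (onFun (dE (P := PV d ℓ m K hd hL) cf ∘ₗ (LinearMap.id - RE (domT hN D hk) cf) ∘ₗ dsE cf))
          (fun c => mulOp (hB hN D c)) (fun c => mulOp (zB hN D hMh1 hP4 c))
          (fun c => Ml hN hk hMh1 hP4 hMha c (band_le (d := d) (ℓ := ℓ) hb₀ hb₁) (hpl c) w cf)
          (fun c => Pl hN hk hMh1 hP4 hMha c (band_le (d := d) (ℓ := ℓ) hb₀ hb₁) (hpl c) w cf) c c' := by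
      rw [kFamT_smul]
      simp only [mul_smul_comm, smul_mul_assoc, smul_smul]
      rw [inv_mul_cancel₀ hcf2, one_smul]
    rw [eK] at h
    refine hasMajorant_T_of_TB hN (hasMajorant_mono (g := geomTB D) (blkV1 hN D) h fun y y' => le_of_eq ?_)
    rw [hVeq, geomTB_dist, show (2 * σ) / 2 = σ by ring]
    rfl
  -- ### (2.91)ᵀ for the genuine operators (`h_□·` , `M_□`, `P_□`, `G_□` symmetric: p38's `hagreeT_cube`, `hinvT_cube`)
  have h291T : (∑ c ∈ (Finset.univ : Finset ↥(cubes D.toDomains)),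
      mulOp (hB hN D c) * Gl hN hk hMh1 hP4 hMha c (band_le (d := d) (ℓ := ℓ) hb₀ hb₁) (hpl c) w cf * mulOp (hB hN D c)) *
        onFun (deltaAE (domT hN D hk) cf w) =
      1 - ∑ c ∈ Finset.univ, ∑ c' ∈ Finset.univ,
        mulOp (hB hN D c') * Gl hN hk hMh1 hP4 hMha c' (band_le (d := d) (ℓ := ℓ) hb₀ hb₁) (hpl c') w cf *
          kFamT (onFun (dE (P := PV d ℓ m K hd hL) cf ∘ₗ (LinearMap.id - RE (domT hN D hk) cf) ∘ₗ dsE cf))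
            (fun c => mulOp (hB hN D c)) (fun c => mulOp (zB hN D hMh1 hP4 c))
            (fun c => Ml hN hk hMh1 hP4 hMha c (band_le (d := d) (ℓ := ℓ) hb₀ hb₁) (hpl c) w cf)
            (fun c => Pl hN hk hMh1 hP4 hMha c (band_le (d := d) (ℓ := ℓ) hb₀ hb₁) (hpl c) w cf) c c' := by
    rw [deltaAE_split]
    exact eq291T_sum Finset.univ _ _ (fun c => mulOp (hB hN D c)) (fun c => mulOp (zB hN D hMh1 hP4 c))
      (fun c => Gl hN hk hMh1 hP4 hMha c (band_le (d := d) (ℓ := ℓ) hb₀ hb₁) (hpl c) w cf)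
      (fun c => Ml hN hk hMh1 hP4 hMha c (band_le (d := d) (ℓ := ℓ) hb₀ hb₁) (hpl c) w cf)
      (fun c => Pl hN hk hMh1 hP4 hMha c (band_le (d := d) (ℓ := ℓ) hb₀ hb₁) (hpl c) w cf)
      (sum_mulOp_hB_sq hN D hMh1 hP)
      (fun c _ => hagreeT_cube hN hk hMh1 hP4 hMha c (band_le (d := d) (ℓ := ℓ) hb₀ hb₁) ha₀ hk2 hM8 hR2 (hpl c) w hcf
        (fun i hi _ => band_of_global hN hk hMh1 hP4 c (le_of_lt hb₀) hcf w hwb i hi))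
      (fun c _ => hinvT_cube hN hk hMh1 hP4 hMha c (band_le (d := d) (ℓ := ℓ) hb₀ hb₁) ha₀ hM8 hR2 (hpl c) w hcf)
      (fun c _ => mulOp_zB_mul_hB hN D hMh hR hP4 c) (fun c _ => mulOp_hB_mul_zB hN D hMh hR hP4 c)
  -- the reversed kernels BEHIND `P`: `P·(h_{□′}G_{□′}K̃_{□,□′}) = (P·h_{□′}G_{□′})·K̃_{□,□′}`
  have hXt' : ∀ c ∈ (Finset.univ : Finset ↥(cubes D.toDomains)), ∀ c' ∈ (Finset.univ : Finset ↥(cubes D.toDomains)),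
      HasMajorant (g := geomT D) (blkV1 hN D)
      (Pp * (mulOp (hB hN D c') * Gl hN hk hMh1 hP4 hMha c' (band_le (d := d) (ℓ := ℓ) hb₀ hb₁) (hpl c') w cf *
        kFamT (onFun (dE (P := PV d ℓ m K hd hL) cf ∘ₗ (LinearMap.id - RE (domT hN D hk) cf) ∘ₗ dsE cf))
          (fun c => mulOp (hB hN D c)) (fun c => mulOp (zB hN D hMh1 hP4 c))
          (fun c => Ml hN hk hMh1 hP4 hMha c (band_le (d := d) (ℓ := ℓ) hb₀ hb₁) (hpl c) w cf)
          (fun c => Pl hN hk hMh1 hP4 hMha c (band_le (d := d) (ℓ := ℓ) hb₀ hb₁) (hpl c) w cf) c c'))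
      (fun y y' => ind (SbigT D hMh1 hP4 c') y * ind (SbigT D hMh1 hP4 c) y' *
        (Θ * (K₁' * CL + K₂' * C₁) * ((geomTB D).M)⁻¹ * Real.exp (-(σ * (geomT D).dist y y')))) := by
    intro c _ c' _
    have h := hXt c c'
    simp only [mul_assoc] at h ⊢
    exact h
  -- ### the first legs: rate `2σ ≥ σ` (indicator `1_{□̃}` as displayed)
  have hfirst : ∀ c ∈ (Finset.univ : Finset ↥(cubes D.toDomains)), HasMajorant (g := geomT D) (blkV1 hN D)
      (Pp * (mulOp (hB hN D c) * Gl hN hk hMh1 hP4 hMha c (band_le (d := d) (ℓ := ℓ) hb₀ hb₁) (hpl c) w cf * mulOp (hB hN D c)) * D')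
      (fun y y' => ind (SbigT D hMh1 hP4 c) y * (CF * Real.exp (-(σ * (geomT D).dist y y')) * PF y')) := by
    intro c _
    refine hasMajorant_mono _ (hleg c) fun y y' => ?_
    have h2 := ind_nonneg (SbigT D hMh1 hP4 c) y
    have h3 : Real.exp (-((2 * σ) * (geomT D).dist y y')) ≤ Real.exp (-(σ * (geomT D).dist y y')) :=
      exp_le_exp_of_rate (by linarith) (hdnn y y')
    have h4 := hPF y'
    exact mul_le_mul_of_nonneg_left (mul_le_mul_of_nonneg_right (mul_le_mul_of_nonneg_left h3 hCF) h4) h2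
  -- ### the one-step gluing
  have hMinv0 : 0 ≤ ((geomTB D).M)⁻¹ := inv_nonneg.2 hMpos.le
  have hθ₀nn : 0 ≤ Θ * (K₁' * CL + K₂' * C₁) * ((geomTB D).M)⁻¹ :=
    mul_nonneg (mul_nonneg hΘ (by positivity)) hMinv0
  have hmain := pairEntry_of_2133T_2134T (g := geomT D) (blkV1 hN D) (Finset.univ : Finset ↥(cubes D.toDomains))
    (fun c => SbigT D hMh1 hP4 c) (hNov_SbigT_of_QbigT D hMh1 hP4 hNbig) (K261 N₀ (d + 1) ((ℓ : ℝ) + 1) 1 (α * σ)) σ α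
    (Θ * (K₁' * CL + K₂' * C₁) * ((geomTB D).M)⁻¹) AT CF PT PF hAT hPT hCF hPF hθ₀nn hK0 hα0 hα1 hσ0.le htri hdnn h261
    (G := onFun (GE (domT hN D hk) hcf hw)) (Δa := onFun (deltaAE (domT hN D hk) cf w)) (D' := D') (Pp := Pp) (h := fun c => hB hN D c)
    (Gl := fun c => Gl hN hk hMh1 hP4 hMha c (band_le (d := d) (ℓ := ℓ) hb₀ hb₁) (hpl c) w cf)
    (Xt := fun c c' => mulOp (hB hN D c') * Gl hN hk hMh1 hP4 hMha c' (band_le (d := d) (ℓ := ℓ) hb₀ hb₁) (hpl c') w cf *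
      kFamT (onFun (dE (P := PV d ℓ m K hd hL) cf ∘ₗ (LinearMap.id - RE (domT hN D hk) cf) ∘ₗ dsE cf))
        (fun c => mulOp (hB hN D c)) (fun c => mulOp (zB hN D hMh1 hP4 c))
        (fun c => Ml hN hk hMh1 hP4 hMha c (band_le (d := d) (ℓ := ℓ) hb₀ hb₁) (hpl c) w cf)
        (fun c => Pl hN hk hMh1 hP4 hMha c (band_le (d := d) (ℓ := ℓ) hb₀ hb₁) (hpl c) w cf) c c')
    (onFun_deltaAE_mul_GE (domT hN D hk) hcf hw) h291T hfirst hXt' hT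
  -- ### cosmetics: `θ₀ = Θ·(K₁′C_L + K₂′C₁)/M`, `M = L·M_h`
  refine hasMajorant_mono _ hmain fun y y' => le_of_eq ?_
  rw [hMeq]
  ring

end Assembly

/-! ## §3  The overlap count and the line-1 sizes discharged -/

section Final

open Classical in
/-- **THE TWO-SIDED ENTRIES AT k LEVELS — OVERLAP AND LINE-1 SIZES DISCHARGED** (`Nbig = 3·9^{d+1}`, p21's `card_filter_mem_QbigT_le`; sizes and supports
by p38's `B6CubeCoeffSizesV1`): line 3ᵀ, the legs of the left factor, the first legs and the right entry displayed; the `O(M⁻¹)` of the reversed kernels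
appears as `(K₁C_L + K₂C₁)/(L·M_h)`. [cite: Balaban1984PropagatorsII, Prop. 2.6 (2.137) p.247, (2.141) p.247, (2.92) p.239, (2.133)–(2.135) p.247] -/
theorem prop26_pairT_kLevel_final_le (d ℓ : ℕ) (hd : 1 ≤ d + 1) (hL : Odd (ℓ + 1) ∧ 1 < ℓ + 1) {b₀ b₁ : ℝ} (hb₀ : 0 < b₀) (hb₁ : b₀ ≤ b₁) :
    ∃ σ₀ : ℝ, 0 < σ₀ ∧ ∀ (σ : ℝ), 0 < σ → σ ≤ σ₀ → ∀ (α : ℝ), 0 ≤ α → α ≤ 1 → ∀ (N₀ : ℕ), 0 < N₀ → ∀ {CD cD : ℝ}, 0 ≤ CD → 0 < cD →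
    ∃ K₁ K₂ M₁ : ℝ, 0 ≤ K₁ ∧ 0 ≤ K₂ ∧ 0 < M₁ ∧
    ∀ (m K : ℕ) {Mh k R : ℕ} {P' : Fin (d + 1) → ℕ}
      (hN : ∀ μ, N0 ℓ Mh k P' μ = (PV d ℓ m K hd hL).sitesPerDir 0) (D : TDomains d ℓ Mh k P' R) (hk : k ≤ m + K) (_ : 2 ≤ k)
      {a : ℕ} (hMha : Mh = (ℓ + 1) ^ a) (hM8 : 8 ≤ Mh) (_ : 2 * (ℓ + 1) ^ 2 ≤ R) (hP5 : ∀ μ, 5 ≤ P' μ) (_ : 4 ≤ ℓ)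
      (hpl : ∀ c : ↥(cubes D.toDomains), Placed ℓ k P' c.1)
      (_ : M₁ ≤ ((ℓ : ℝ) + 1) * Mh) (_ : N₀ + 1 ≤ R * ((ℓ + 1) * Mh))
      (_ : Real.exp (-(α * σ)) * ((ℓ : ℝ) + 1) ^ ((2 * (d + 1 : ℕ) : ℝ) / N₀) < 1)
      {cf : ℝ} (hcf : cf ≠ 0) {w : BondIdx (domT hN D hk) → ℝ} (hw : ∀ i, 0 < w i) (_ : GlobalBand b₀ b₁ cf w)
      -- line 3ᵀ (p22's `line3_cube_transpose` shape)
      (_ : ∀ c : ↥(cubes D.toDomains), HasMajorant (g := geomTB D) (blkV1 hN D)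
        (mulOp (hB hN D c) *
          (onFun (dE (P := PV d ℓ m K hd hL) cf ∘ₗ (LinearMap.id - RE (domT hN D hk) cf) ∘ₗ dsE cf) -
            Pl hN hk (one_le_of_eight_le hM8) (four_le_of_five_le hP5) hMha c (band_le (d := d) (ℓ := ℓ) hb₀ hb₁) (hpl c) w cf) *
          mulOp (zB hN D (one_le_of_eight_le hM8) (four_le_of_five_le hP5) c))
        (fun y y'' => CD * cf ^ 2 * Real.exp (-(cD * (geomTB D).M)) / (geomTB D).len y ^ 2 * Real.exp (-((2 * σ) * (geomTB D).dist y y''))))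
      -- the left factor and its legs
      (Pp : Module.End ℝ (PBond (PV d ℓ m K hd hL) 0 → ℝ)) {CL C₁ : ℝ} (_ : 0 ≤ CL) (_ : 0 ≤ C₁)
      (_ : ∀ c : ↥(cubes D.toDomains), HasMajorant (g := geomT D) (blkV1 hN D)
        (Pp * mulOp (hB hN D c) * Gl hN hk (one_le_of_eight_le hM8) (four_le_of_five_le hP5) hMha c (band_le (d := d) (ℓ := ℓ) hb₀ hb₁) (hpl c) w cf)
        (fun y y'' => CL * pref cf y * Real.exp (-((2 * σ) * (geomT D).dist y y''))))
      (_ : ∀ (c : ↥(cubes D.toDomains)) (e : Fin (d + 1) × Bool), HasMajorant (g := geomT D) (blkV1 hN D)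
        (Pp * mulOp (hB hN D c) * Gl hN hk (one_le_of_eight_le hM8) (four_le_of_five_le hP5) hMha c (band_le (d := d) (ℓ := ℓ) hb₀ hb₁) (hpl c) w cf *
          EC hN hk (one_le_of_eight_le hM8) (four_le_of_five_le hP5) hMha c (band_le (d := d) (ℓ := ℓ) hb₀ hb₁) (hpl c) w cf e)
        (fun y y'' => C₁ * pref cf y * Real.exp (-((2 * σ) * (geomT D).dist y y''))))
      (_ : ∀ c : ↥(cubes D.toDomains), OutLoc (g := geomT D) (blkV1 hN D)
        (Pp * mulOp (hB hN D c) * Gl hN hk (one_le_of_eight_le hM8) (four_le_of_five_le hP5) hMha c (band_le (d := d) (ℓ := ℓ) hb₀ hb₁) (hpl c) w cf)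
        (SbigT D (one_le_of_eight_le hM8) (four_le_of_five_le hP5) c))
      -- the right factor, the first legs behind the left factor, the right entry
      (D' : Module.End ℝ (PBond (PV d ℓ m K hd hL) 0 → ℝ)) (PF : (geomT D).Site → ℝ) (_ : ∀ y, 0 ≤ PF y) {CF : ℝ} (_ : 0 ≤ CF)
      (_ : ∀ c : ↥(cubes D.toDomains), HasMajorant (g := geomT D) (blkV1 hN D)
        (Pp * (mulOp (hB hN D c) * Gl hN hk (one_le_of_eight_le hM8) (four_le_of_five_le hP5) hMha c (band_le (d := d) (ℓ := ℓ) hb₀ hb₁) (hpl c) w cf *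
          mulOp (hB hN D c)) * D')
        (fun y y' => ind (SbigT D (one_le_of_eight_le hM8) (four_le_of_five_le hP5) c) y * (CF * Real.exp (-((2 * σ) * (geomT D).dist y y')) * PF y')))
      (PT : (geomT D).Site → ℝ) (_ : ∀ y, 0 ≤ PT y) {AT : ℝ} (_ : 0 ≤ AT)
      (_ : HasMajorant (g := geomT D) (blkV1 hN D) (onFun (GE (domT hN D hk) hcf hw) * D')
        (fun y y' => AT * Real.exp (-(σ * (geomT D).dist y y')) * PT y')),
      HasMajorant (g := geomT D) (blkV1 hN D) (Pp * onFun (GE (domT hN D hk) hcf hw) * D')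
        (fun y y' => ((3 * 9 ^ (d + 1) : ℕ) : ℝ) * CF * Real.exp (-(σ * (geomT D).dist y y')) * PF y' +
          AT * (((3 * 9 ^ (d + 1) : ℕ) : ℝ) * ((3 * 9 ^ (d + 1) : ℕ) : ℝ) * ((K₁ * CL + K₂ * C₁) * (((ℓ : ℝ) + 1) * Mh)⁻¹) *
            K261 N₀ (d + 1) ((ℓ : ℝ) + 1) 1 (α * σ)) * Real.exp (-((1 - α) * σ * (geomT D).dist y y')) * PT y') := by
  obtain ⟨σ₀, hσ₀, h⟩ := prop26_pairT_kLevel_assembly_le d ℓ hd hL hb₀ hb₁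
  refine ⟨σ₀, hσ₀, fun σ hσ0 hσle α hα0 hα1 N₀ hN₀ CD cD hCD hcD => ?_⟩
  have hs₁ : 0 ≤ C1F d ℓ * ((ℓ : ℝ) + 1) ^ 3 := by have := C1F_nonneg d ℓ; positivity
  have hs₂ : 0 ≤ ((d : ℝ) + 1) * C2F d ℓ * ((ℓ : ℝ) + 1) := by have := C2F_nonneg d ℓ; positivity
  obtain ⟨K₁, K₂, M₁, hK₁, hK₂, hM₁, h2⟩ := h σ hσ0 hσle α hα0 hα1 N₀ hN₀ (3 * 9 ^ (d + 1)) hs₁ hs₂ hCD hcD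
  refine ⟨K₁, K₂, M₁, hK₁, hK₂, hM₁, ?_⟩
  intro m K Mh k R P' hN D hk hk2 a hMha hM8 hR2 hP5 hℓ hpl hLM hRM hθ cf hcf w hw hwb hD3 Pp CL C₁ hCL hC₁ hLft hLftE hLout
    D' PF hPF CF hCF hleg PT hPT AT hAT hT
  exact h2 m K hN D hk hk2 hMha hM8 hR2 hP5 hℓ hpl hLM hRM hθ hcf hw hwb
    (card_filter_mem_QbigT_le D hL (le_trans (by norm_num) hM8) hR2 (one_le_of_eight_le hM8) (four_le_of_five_le hP5))
    (fun c e x => abs_cfC_le hN hk _ _ hMha c _ hM8 hR2 hP5 (hpl c) w cf e x)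
    (fun c e x hx => cfC_supp hN hk _ _ hMha c _ hM8 hR2 hP5 (hpl c) w cf e x hx)
    (fun c x => abs_c0C_le hN hk _ _ hMha c _ hM8 hR2 hP5 (hpl c) w cf x)
    (fun c x hx => c0C_supp hN hk _ _ hMha c _ hM8 hR2 hP5 (hpl c) w cf x hx) hD3 Pp hCL hC₁ hLft hLftE hLout
    D' PF hPF hCF hleg PT hPT hAT hT

end Final

end Literature.MathematicalPhysics.QuantumFieldTheory.Balaban1983to89.B6Prop26PairMirrorAssemblyV1

end
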